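import Literature.NumberTheory.LFunctions.WeilTwoPrimeCertificateDeflated
import Literature.NumberTheory.LFunctions.WeilTwoPrimeCertificateMargin
import HarnessLib

/-!
# The deflated two-prime certificate, one parity block (sector form)

Topic `Literature/NumberTheory/LFunctions`; companion of `WeilTwoPrimeCertificateDeflated.lean`.  For a test function of parity
`p` the moments of the other parity vanish (`weilMoment_even_of_odd` and its even twin `weilMoment_odd_of_even`), so only the
block `p` of the augmented matrix `P_r + Σ μ ĉ ĉᵀ` has to be checked — exactly as `WeilTwoPrimeCertificateMargin.lean` does for the
plain format.  This lets the two sectors carry different `(β, R)`: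
`WeilCert23.checkR₁ β R p` and `WeilCert23.weilTwoPrimeQuadratic_rankOne_bound_of_checkR₁` (hypothesis: `g(-x) = (-1)^p g(x)`).
All proved; no named facts.  (Prover B gen 3, GroundBarta rung 4, G2 Lean side.)

## References
* H. Yoshida, *On Hermitian forms attached to zeta functions*, Adv. Stud. Pure Math. 21 (1992), §2, §6, Thm 1. [Yoshida1992]
-/

noncomputable section

open Complex Finset MeasureTheory Set Filter
open scoped Real Topology ComplexConjugate BigOperators

namespace Literature.NumberTheory.LFunctions

open Literature.Analysis.ValidatedNumerics.Numerics
open Literature.Analysis.SpecialFunctions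

/-- Even functions have vanishing odd moments: `∫ g(x) (x/a)^q dx = 0` for odd `q` if `g(−x) = g(x)`. [folklore] -/
theorem weilMoment_odd_of_even {g : ℝ → ℂ} (heven : ∀ x, g (-x) = g x) (a : ℝ) {q : ℕ} (hq : Odd q) :
    weilMoment a g q = 0 := by
  have h := integral_neg_eq_self (fun x : ℝ ↦ g x * ((((x / a) ^ q : ℝ)) : ℂ)) volume
  have h2 : ∀ x : ℝ, g (-x) * ((((-x / a) ^ q : ℝ)) : ℂ) = -(g x * ((((x / a) ^ q : ℝ)) : ℂ)) := fun x ↦ by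
    rw [heven, neg_div, hq.neg_pow]; push_cast; ring
  simp only [h2, integral_neg] at h
  unfold weilMoment
  have : (∫ x : ℝ, g x * ((((x / a) ^ q : ℝ)) : ℂ)) = -(∫ x : ℝ, g x * ((((x / a) ^ q : ℝ)) : ℂ)) := h.symm
  linear_combination this / 2

namespace WeilCert

variable {c : WeilCert}

/-- **The generic algebraic core on ONE parity block.**  If the moments of parity `1 − p` vanish and block `p` of the
(arbitrary, parity-diagonal) matrix `P` passes `checkBlockP P κ p`, the reduced form plus `κ ×` Bessel is `≥ 0`. [folklore] -/
theorem core_nonnegP_block {P : ℕ → ℕ → ℚ} {κ : ℚ} (hN : c.N + 1 = 2 * c.nb) {p : ℕ} (hp : p < 2)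
    (hPcross : ∀ {k l : ℕ}, k % 2 ≠ l % 2 → P k l = 0) (hb : c.checkBlockP P κ p = true) (M : ℕ → ℂ)
    (hM : ∀ i, M (2 * i + (1 - p)) = 0) :
    0 ≤ (∑ k ∈ range (c.N + 1), ∑ l ∈ range (c.N + 1), (P k l : ℝ) * (conj (M k) * M l).re) +
      (κ : ℝ) *
        (2 * (∑ k ∈ range (c.N + 1), conj (c.uVec M k) * M k).re -
          (∑ k ∈ range (c.N + 1), ∑ l ∈ range (c.N + 1),
            conj (c.uVec M k) * c.uVec M l * (gramH (c.a0 : ℝ) k l : ℂ)).re) := by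
  set a : ℝ := (c.a0 : ℝ) with ha_def
  have hDC : c.checkDC p = true := by
    unfold WeilCert.checkBlockP at hb; rw [Bool.and_eq_true] at hb; exact hb.1
  -- the other block's coordinates vanish
  have hy : ∀ j, c.yVec M (1 - p) j = 0 := fun j ↦ by
    unfold WeilCert.yVec
    exact Finset.sum_eq_zero fun i _ ↦ by rw [hM, mul_zero]
  have hu : ∀ i, c.uVec M (2 * i + (1 - p)) = 0 := fun i ↦ by
    have h := WeilCert.uVec_block (c := c) M (1 - p) i (by omega)
    rw [h]
    exact Finset.sum_eq_zero fun j _ ↦ by rw [hy, mul_zero]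
  have key : (∑ k ∈ range (c.N + 1), ∑ l ∈ range (c.N + 1), (P k l : ℝ) * (conj (M k) * M l).re) +
      (κ : ℝ) *
        (2 * (∑ k ∈ range (c.N + 1), conj (c.uVec M k) * M k).re -
          (∑ k ∈ range (c.N + 1), ∑ l ∈ range (c.N + 1),
            conj (c.uVec M k) * c.uVec M l * (gramH a k l : ℂ)).re) =
      ((∑ k ∈ range (c.N + 1), ∑ l ∈ range (c.N + 1), (P k l : ℂ) * (conj (M k) * M l)) +
        (κ : ℂ) *
          (2 * ∑ k ∈ range (c.N + 1), conj (c.uVec M k) * M k -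
            ∑ k ∈ range (c.N + 1), ∑ l ∈ range (c.N + 1),
              conj (c.uVec M k) * c.uVec M l * (gramH a k l : ℂ))).re := by
    have e1 : (∑ k ∈ range (c.N + 1), ∑ l ∈ range (c.N + 1), (P k l : ℂ) * (conj (M k) * M l)).re =
        ∑ k ∈ range (c.N + 1), ∑ l ∈ range (c.N + 1), (P k l : ℝ) * (conj (M k) * M l).re := by
      rw [Complex.re_sum]
      refine Finset.sum_congr rfl fun k _ ↦ ?_
      rw [Complex.re_sum]
      refine Finset.sum_congr rfl fun l _ ↦ ?_
      rw [show ((P k l : ℚ) : ℂ) = (((P k l : ℚ) : ℝ) : ℂ) by norm_cast, Complex.re_ofReal_mul]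
    have e2 : ∀ (κ : ℚ) (X Y : ℂ), ((κ : ℂ) * (2 * X - Y)).re = (κ : ℝ) * (2 * X.re - Y.re) := by
      intro κ X Y
      rw [show ((κ : ℚ) : ℂ) = (((κ : ℚ) : ℝ) : ℂ) by norm_cast, Complex.re_ofReal_mul]
      congr 1
      simp [Complex.mul_re]
    rw [Complex.add_re, e1, e2]
  rw [key]
  have hH : ∀ k l, k % 2 ≠ l % 2 → (gramH a k l : ℂ) = 0 := by
    intro k l hkl
    have hodd : Odd (k + l) := by
      rcases Nat.even_or_odd k with hk | hk <;> rcases Nat.even_or_odd l with hl | hl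
      · exact absurd (by rw [Nat.even_iff.1 hk, Nat.even_iff.1 hl]) hkl
      · exact hk.add_odd hl
      · exact hk.add_even hl
      · exact absurd (by rw [Nat.odd_iff.1 hk, Nat.odd_iff.1 hl]) hkl
    rw [gramH, hodd.neg_one_pow]
    simp
  rw [hN, WeilAlg.sum_sum_range_two_mul c.nb _ (fun k l hkl ↦ by rw [hPcross hkl]; simp),
    WeilAlg.sum_range_two_mul c.nb,
    WeilAlg.sum_sum_range_two_mul c.nb _ (fun k l hkl ↦ by rw [hH k l hkl]; simp)]
  have hG : ∀ q i i', q < 2 → (gramH a (2 * i + q) (2 * i' + q) : ℂ) = (c.hBlkQ q i i' : ℂ) := by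
    intro q i i' hq
    have hev : Even (2 * i + q + (2 * i' + q)) := ⟨i + i' + q, by ring⟩
    rw [gramH, hev.neg_one_pow, WeilCert.hBlkQ, ha_def]
    push_cast
    ring
  have hG0 : ∀ i i', (gramH a (2 * i) (2 * i') : ℂ) = (c.hBlkQ 0 i i' : ℂ) := fun i i' ↦ by
    simpa using hG 0 i i' (by norm_num)
  have hG1 : ∀ i i', (gramH a (2 * i + 1) (2 * i' + 1) : ℂ) = (c.hBlkQ 1 i i' : ℂ) := fun i i' ↦ hG 1 i i' (by norm_num)
  simp_rw [hG0, hG1]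
  have e := WeilCert.block_identityP (c := c) (P := P) κ (p := p) hp hDC M
  interval_cases p
  · -- p = 0: the odd block vanishes
    have hM1 : ∀ i, M (2 * i + 1) = 0 := fun i ↦ by simpa using hM i
    have hu1 : ∀ i, c.uVec M (2 * i + 1) = 0 := fun i ↦ by simpa using hu i
    simp only [add_zero] at e
    simp only [hM1, hu1, map_zero, zero_mul, mul_zero, Finset.sum_const_zero, add_zero]
    rw [e]
    exact WeilAlg.re_herm_nonneg c.nb _ (fun x ↦ WeilCert.spFunP_quad_nonneg hb x) _
  · -- p = 1: the even block vanishes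
    have hM0 : ∀ i, M (2 * i) = 0 := fun i ↦ by simpa using hM i
    have hu0 : ∀ i, c.uVec M (2 * i) = 0 := fun i ↦ by simpa using hu i
    simp only [hM0, hu0, map_zero, zero_mul, mul_zero, Finset.sum_const_zero, zero_add]
    rw [e]
    exact WeilAlg.re_herm_nonneg c.nb _ (fun x ↦ WeilCert.spFunP_quad_nonneg hb x) _

/-- **The rank-one core on one block.** [folklore] -/
theorem core_nonnegR_block {nu : List ℚ} {κ : ℚ} (R : List (ℚ × ℕ × List ℚ)) (hN : c.N + 1 = 2 * c.nb) {p : ℕ} (hp : p < 2)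
    (hb : c.checkBlockP (fun k l ↦ c.prQ nu k l + rankOneQ R k l) κ p = true) (M : ℕ → ℂ)
    (hM : ∀ i, M (2 * i + (1 - p)) = 0) :
    0 ≤ (∑ k ∈ range (c.N + 1), ∑ l ∈ range (c.N + 1), (c.prQ nu k l : ℝ) * (conj (M k) * M l).re) +
      (κ : ℝ) *
        (2 * (∑ k ∈ range (c.N + 1), conj (c.uVec M k) * M k).re -
          (∑ k ∈ range (c.N + 1), ∑ l ∈ range (c.N + 1),
            conj (c.uVec M k) * c.uVec M l * (gramH (c.a0 : ℝ) k l : ℂ)).re) +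
      (R.map fun r ↦ (r.1 : ℝ) * ‖∑ k ∈ range (c.N + 1), ((maskV r k : ℚ) : ℂ) * M k‖ ^ 2).sum := by
  have hcross : ∀ {k l : ℕ}, k % 2 ≠ l % 2 → c.prQ nu k l + rankOneQ R k l = 0 := fun hkl ↦ by
    rw [c.prQ_cross nu hkl, rankOneQ_cross R hkl, add_zero]
  have h := core_nonnegP_block (P := fun k l ↦ c.prQ nu k l + rankOneQ R k l) hN hp hcross hb M hM
  have e : ∑ k ∈ range (c.N + 1), ∑ l ∈ range (c.N + 1),
      (((fun k l ↦ c.prQ nu k l + rankOneQ R k l) k l : ℚ) : ℝ) * (conj (M k) * M l).re =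
      (∑ k ∈ range (c.N + 1), ∑ l ∈ range (c.N + 1), (c.prQ nu k l : ℝ) * (conj (M k) * M l).re) +
        ∑ k ∈ range (c.N + 1), ∑ l ∈ range (c.N + 1), ((rankOneQ R k l : ℚ) : ℝ) * (conj (M k) * M l).re := by
    rw [← Finset.sum_add_distrib]
    refine Finset.sum_congr rfl fun k _ ↦ ?_
    rw [← Finset.sum_add_distrib]
    refine Finset.sum_congr rfl fun l _ ↦ ?_
    push_cast
    ring
  rw [e, rankOneQ_quad] at h
  linarith

end WeilCert

namespace WeilCert23

variable (c : WeilCert23)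

/-- **Sector checker**: as `checkR` but only the parity block `p` of the augmented matrix. [folklore] -/
def checkR₁ (β : ℚ) (R : List (ℚ × ℕ × List ℚ)) (p : ℕ) : Bool :=
  checkCells₂₃ c.base.prec c.j c.base.wL c.base.T c.base.mwT c.cells && c.checkScalars && c.checkNu &&
    decide (β ≤ c.kappaQ) && decide (p < 2) &&
    c.base.checkBlockP (fun k l ↦ c.base.prQ c.nuTab k l + rankOneQ R k l) (c.kappaQ - β) p

variable {c}

/-- **Soundness of the sector form of the deflated two-prime certificate.**  If `c.checkR₁ β R p = true` then every test function
`g` on `[-b, b]` of parity `p` (`g(-x) = (-1)^p g(x)`) satisfies `β‖g‖₂² ≤ E₂₃(g) + Σ_{(μ,q,c)∈R} μ |Σ_k ĉ_k M_k(g)|²`. [folklore] -/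
theorem weilTwoPrimeQuadratic_rankOne_bound_of_checkR₁ {β : ℚ} {R : List (ℚ × ℕ × List ℚ)} {p : ℕ}
    (h : c.checkR₁ β R p = true) {g : ℝ → ℂ} (hg : IsWeilTest g) (hsupp : tsupport g ⊆ Icc (-(c.b : ℝ)) c.b)
    (hpar : ∀ x, g (-x) = (-1) ^ p * g x) :
    (β : ℝ) * weilNorm2Sq g ≤ weilTwoPrimeQuadratic g +
      (R.map fun r ↦ (r.1 : ℝ) * ‖∑ k ∈ range (c.base.N + 1),
        ((maskV r k : ℚ) : ℂ) * weilMoment c.base.a0 g k‖ ^ 2).sum := by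
  unfold checkR₁ at h
  simp only [Bool.and_eq_true, decide_eq_true_eq] at h
  obtain ⟨⟨⟨⟨⟨hcells3, hsc⟩, hnuchk⟩, hβ⟩, hp⟩, hb⟩ := h
  obtain ⟨-, hbpos, hba, -, -, -, -, hN, -⟩ := scalars_spec hsc
  have hb0' : (0 : ℝ) < c.b := by exact_mod_cast hbpos
  have hba' : ((c.b : ℚ) : ℝ) ≤ (c.base.a0 : ℝ) := by exact_mod_cast hba
  have ha : (0 : ℝ) < (c.base.a0 : ℝ) := by linarith
  have hsupp' : tsupport g ⊆ Icc (-(c.base.a0 : ℝ)) c.base.a0 := hsupp.trans (Icc_subset_Icc (by linarith) hba')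
  have step3 := margin_step3 hcells3 hsc hnuchk hg hsupp
  have hbes := weilNorm2Sq_ge_bessel hg ha hsupp' (c.base.N + 1) (c.base.uVec (weilMoment c.base.a0 g))
  have hM : ∀ i, weilMoment c.base.a0 g (2 * i + (1 - p)) = 0 := by
    intro i
    interval_cases p
    · exact weilMoment_odd_of_even (fun x ↦ by simpa using hpar x) _ ⟨i, by ring⟩
    · exact weilMoment_even_of_odd (fun x ↦ by simpa using hpar x) _ ⟨i, by omega⟩
  have hcore := WeilCert.core_nonnegR_block (c := c.base) (nu := c.nuTab) (κ := c.kappaQ - β) R hN hp hb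
    (weilMoment c.base.a0 g) hM
  have hκ' : (0 : ℝ) ≤ ((c.kappaQ - β : ℚ) : ℝ) := by exact_mod_cast sub_nonneg.2 hβ
  have h4 := mul_le_mul_of_nonneg_left hbes hκ'
  push_cast at hcore h4 ⊢
  nlinarith [step3, hcore, h4]

end WeilCert23

end Literature.NumberTheory.LFunctions

end
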